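import Summits.ResolutionOfSingularities.ResolutionOfSingularities.Theorems.BirthCountCutKernels
import HarnessLib

/-! # BirthCountCutKernels2 — FILE B of the decomp-res-lens-4 g38 node «BirthCountCut» (see the module docstring of
`Theorems/BirthCountCutKernels.lean` = FILE A for the thesis, the law, the cut, the honest tags and the sources). -/

set_option linter.dupNamespace false
set_option linter.unusedSectionVars false

noncomputable section

open CategoryTheory AlgebraicGeometry IsLocalRing TopologicalSpace
open Literature.AlgebraicGeometry.Resolution
open Summit.ResolutionOfSingularities.ResolutionOfSingularities.Theorems
open WeakOrderReduction ForcedTowerClasses DivergentTowerClasses MonomialTowerClasses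
open HugDimensionClasses HugDimensionKernels SurfaceShadowClasses SurfaceShadowKernels
open NearPointCut (SingularClass)
open Scheme.IdealSheafData (vanishingIdeal)

universe u

namespace Summit.ResolutionOfSingularities.ResolutionOfSingularities.Theorems.HugValuationCut

/-! ## ══ FILE B `Theorems/BirthCountCutKernels2.lean` (§122a′–§122b; cone-free; imports FILE A) ══ -/

section BranchPrimes

/-! ### §122a′ near-branch primes: general stalk lemmas -/

variable {X : Scheme.{0}}

/-- a PROPER generization of `t` gives a NON-maximal prime `𝔭_η ⊂ 𝒪_t`. [folklore] -/
theorem primeOfSpecializes_ne_maximalIdeal_of_ne {η t : X} (h : η ⤳ t) (hne : η ≠ t) :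
    primeOfSpecializes h ≠ maximalIdeal (X.presheaf.stalk t) := by
  intro heq
  have h1 : t ⤳ η := specializes_of_primeOfSpecializes_le h (specializes_refl t)
    (by rw [primeOfSpecializes_refl, heq])
  exact hne (h.antisymm h1).eq

/-- distinct comparable generizations of `t` give STRICTLY comparable primes. [folklore] -/
theorem primeOfSpecializes_lt_of_specializes_of_ne {η η' t : X} (h : η ⤳ t) (h' : η' ⤳ t) (hs : η' ⤳ η)
    (hne : η' ≠ η) : primeOfSpecializes h' < primeOfSpecializes h :=
  lt_of_le_of_ne (primeOfSpecializes_le_of_specializes h h' hs) fun heq =>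
    hne ((specializes_of_primeOfSpecializes_le h' h heq.symm.le).antisymm hs).eq.symm

/-- transport of `primeOfSpecializes` along an equality of the generic point. [folklore] -/
theorem primeOfSpecializes_congr_left {η η' t : X} (e : η = η') (h : η ⤳ t) (h' : η' ⤳ t) :
    primeOfSpecializes h = primeOfSpecializes h' := by
  subst e
  rfl

/-- transport of the quotient dimension along an equality of the special point. [folklore] -/
theorem ringKrullDim_quotient_primeOfSpecializes_congr_right {η t t' : X} (e : t = t') (h : η ⤳ t) (h' : η ⤳ t') :
    ringKrullDim (X.presheaf.stalk t ⧸ primeOfSpecializes h) = ringKrullDim (X.presheaf.stalk t' ⧸ primeOfSpecializes h') := by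
  subst e
  rfl

/-- **the comap of a near-branch prime under the re-based stalk map** `stalkMapCongr` is the prime of the image branch.
[folklore] -/
theorem comap_stalkMapCongr_primeOfSpecializes {X' : Scheme.{0}} (π : X' ⟶ X) (x' q : X') (hq : q = x') {ζ : X'}
    (hζ : ζ ⤳ q) (hζ' : π.base ζ ⤳ π.base x') :
    (primeOfSpecializes hζ).comap (stalkMapCongr π x' q hq) = primeOfSpecializes hζ' := by
  subst hq
  rw [stalkMapCongr_self]
  exact comap_stalkMap_primeOfSpecializes π hζ

/-- in a factorial domain a prime of height `≤ 1` is principal (height `0`: it is `(0)`; height `1`: Görtz–Wedhorn B.75 (2)).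
[folklore] -/
theorem isPrincipal_of_height_le_one {R : Type*} [CommRing R] [IsDomain R] [UniqueFactorizationMonoid R] {P : Ideal R}
    [P.IsPrime] (h : P.height ≤ 1) : P.IsPrincipal := by
  rcases eq_or_lt_of_le h with h1 | h0
  · exact UniqueFactorizationMonoid.isPrincipal_of_height_eq_one h1
  · have h0' : P.height = 0 := Order.lt_one_iff.mp h0
    rw [Ideal.height_eq_zero_iff_eq_bot] at h0'
    rw [h0']
    infer_instance

end BranchPrimes

section BranchStructure

/-! ### §122b (L1) the structure of the near-branches of an OCCULT principal companion in ring dimension 3 -/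

variable {k : Type} [Field k]

/-- the weight locus `{y | ord_y F ≥ a}` of a tower stage is closed (upper semicontinuity of the order on an excellent
regular scheme; tree `isOpen_setOf_idealOrder_le`). [folklore] -/
theorem isClosed_setOf_le_idealOrder_tower (T : ForcedTower) (g : T.St 0 ⟶ Spec (.of k)) (hB : IsBase (T.St 0) g)
    (i : ℕ) (F : (T.St i).IdealSheafData) (a : ℕ) : IsClosed {y : T.St i | ((a : ℕ) : ℕ∞) ≤ idealOrder F y} := by
  cases a with
  | zero =>
    convert isClosed_univ
    exact Set.eq_univ_of_forall fun y => by simp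
  | succ a =>
    rw [← isOpen_compl_iff]
    convert isOpen_setOf_idealOrder_le T i a g hB F using 1
    ext y
    simp only [Set.mem_compl_iff, Set.mem_setOf_eq, not_le, Nat.cast_succ]
    exact ENat.lt_coe_add_one_iff

/-- **(L1a) OCCULTNESS EXCLUDES REGULAR-SURFACE NEAR-BRANCHES — no near-branch prime is principal.**  If the prime `𝔮 = 𝔭_η`
of a near-branch `η` of a principal factor `h` of weight `a ≥ 1` at `x_i` were principal, `𝔮 = (s)`, then `h ∈ 𝔮^{(a)}`
(`ord_η h ≥ a`, `𝒪_η = (𝒪_{x_i})_𝔮`) gives `s^a ∣ h`, so `h = unit · s^a` with `s ∉ 𝔪²` (the order of `h` is exactly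
`a`), and `𝓘_{x_i} = (s) · (s^{a-1} K_{x_i})` is a factorization with a factor of weight ONE — absolute contact, excluded in
an occult tower (`occult_letters`). (Sources: CossartPiltant2008 proof of Prop. 4.2; GortzWedhorn2020 Prop. B.75;
Matsumura1987 Thm. 20.3.) -/
theorem not_isPrincipal_primeOfSpecializes_of_mem_brSet (T : ForcedTower) (g : T.St 0 ⟶ Spec (.of k))
    (hB : IsBase (T.St 0) g) (hocc : ¬ LatentFactorTower T) {i a b : ℕ} {G K : (T.St i).IdealSheafData}
    (hF : FactorAt T i a b G K) (hP : (stalkIdeal G (T.pt i)).IsPrincipal) (ha : 1 ≤ a) {η : T.St i}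
    (hη : η ∈ brSet T i a G) : ¬ (primeOfSpecializes hη.1).IsPrincipal := by
  haveI := (tower_isLocallyNoetherian_isRegular T g hB i).1
  have hreg := tower_isRegular T g hB i
  haveI : IsRegularLocalRing ((T.St i).presheaf.stalk (T.pt i)) := hreg _
  haveI : IsDomain ((T.St i).presheaf.stalk (T.pt i)) := isDomain_of_isRegularLocalRing _
  haveI : UniqueFactorizationMonoid ((T.St i).presheaf.stalk (T.pt i)) := hreg.uniqueFactorizationMonoid_stalk _
  rintro ⟨⟨s, hs⟩⟩
  obtain ⟨⟨h, hh⟩⟩ := hP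
  change primeOfSpecializes hη.1 = Ideal.span {s} at hs
  change stalkIdeal G (T.pt i) = Ideal.span {h} at hh
  set φ := ((T.St i).presheaf.stalkSpecializes hη.1).hom with hφ
  -- `G_η = G_{x_i}·𝒪_η ⊆ 𝔪_η^a`
  have h1 : stalkIdeal G η ≤ maximalIdeal _ ^ a := (le_idealOrder_iff G η a).mp hη.2.2
  have h2 : stalkIdeal G η = (stalkIdeal G (T.pt i)).map φ := (stalkIdeal_map_stalkSpecializes G hη.1).symm
  have hφh : φ h ∈ maximalIdeal _ ^ a :=
    h1 (h2 ▸ Ideal.mem_map_of_mem φ (hh ▸ Ideal.mem_span_singleton_self h))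
  -- the order of `h` at `x_i` is exactly `a`
  have hGa : ¬ stalkIdeal G (T.pt i) ≤ maximalIdeal _ ^ (a + 1) := by
    rw [← le_idealOrder_iff, hF.2.1, Nat.cast_le]
    omega
  -- `h ∈ 𝔮`
  have hmem : h ∈ primeOfSpecializes hη.1 := by
    change h ∈ (maximalIdeal _).comap φ
    rw [Ideal.mem_comap]
    exact Ideal.pow_le_self (by omega) hφh
  by_cases hs0 : s = 0
  · -- `𝔮 = (0)`: then `h = 0`, and the order of `h` would be infinite
    rw [hs, hs0, Ideal.span_singleton_eq_bot.mpr rfl, Ideal.mem_bot] at hmem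
    apply hGa
    rw [hh, hmem, Ideal.span_singleton_eq_bot.mpr rfl]
    exact bot_le
  -- `𝔮 = (s)` with `s` a prime element; `𝒪_η = (𝒪_{x_i})_𝔮`
  have hsP : Prime s := (Ideal.span_singleton_prime hs0).mp (hs ▸ inferInstance)
  letI := φ.toAlgebra
  haveI : IsLocalization.AtPrime ((T.St i).presheaf.stalk η) (primeOfSpecializes hη.1) :=
    isLocalizationAtPrime_stalkSpecializes hη.1
  have hf : algebraMap _ ((T.St i).presheaf.stalk η) h ∈
      ((primeOfSpecializes hη.1) ^ a).map (algebraMap _ ((T.St i).presheaf.stalk η)) := by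
    rw [Ideal.map_pow, IsLocalization.AtPrime.map_eq_maximalIdeal (primeOfSpecializes hη.1) ((T.St i).presheaf.stalk η)]
    exact hφh
  obtain ⟨t, ht⟩ := pow_dvd_of_algebraMap_mem_map_pow (primeOfSpecializes hη.1) hsP hs hf
  have hsm : s ∈ maximalIdeal _ :=
    (IsLocalRing.le_maximalIdeal (Ideal.IsPrime.ne_top inferInstance) : primeOfSpecializes hη.1 ≤ _)
      (hs ▸ Ideal.mem_span_singleton_self s)
  -- `t` is a unit
  have htu : IsUnit t := by
    by_contra htu
    have htm : t ∈ maximalIdeal _ := (IsLocalRing.mem_maximalIdeal t).mpr htu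
    apply hGa
    rw [hh, Ideal.span_singleton_le_iff_mem, ht, pow_succ]
    exact Ideal.mul_mem_mul (Ideal.pow_mem_pow hsm a) htm
  -- `s ∉ 𝔪²`
  have hs2 : s ∉ maximalIdeal _ ^ 2 := by
    intro hs2
    apply hGa
    rw [hh, Ideal.span_singleton_le_iff_mem, ht]
    have hsa : s ^ a ∈ (maximalIdeal _ ^ 2) ^ a := Ideal.pow_mem_pow hs2 a
    rw [← pow_mul] at hsa
    exact Ideal.mul_mem_right t _ (Ideal.pow_le_pow_right (by omega) hsa)
  -- the weight-one re-factorization `𝓘 = (s) · (s^{a-1} K)`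
  obtain ⟨S, hS⟩ := FInjectiveMacaulayfication.SpreadSupportControl.exists_idealSheafData_stalkIdeal_eq (T.St i) (T.pt i) (Ideal.span {s})
  obtain ⟨K', hK'⟩ :=
    FInjectiveMacaulayfication.SpreadSupportControl.exists_idealSheafData_stalkIdeal_eq (T.St i) (T.pt i) (Ideal.span {s ^ (a - 1)} * stalkIdeal K (T.pt i))
  have hD' : stalkIdeal (T.D i).ideal (T.pt i) = stalkIdeal S (T.pt i) * stalkIdeal K' (T.pt i) := by
    rw [hF.1, hS, hK', ← mul_assoc, Ideal.span_singleton_mul_span_singleton, ← pow_succ', Nat.sub_add_cancel ha, hh, ht,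
      Ideal.span_singleton_mul_right_unit htu]
  -- `ord (s) = 1`
  have hSne : stalkIdeal S (T.pt i) ≠ ⊥ := by
    rw [hS, Ne, Ideal.span_singleton_eq_bot]
    exact hs0
  obtain ⟨d, hd⟩ := ENat.ne_top_iff_exists.mp (idealOrder_lt_top_of_stalkIdeal_ne_bot hSne).ne
  have hd1 : ((1 : ℕ) : ℕ∞) ≤ idealOrder S (T.pt i) := by
    rw [le_idealOrder_iff, hS, Ideal.span_singleton_le_iff_mem, pow_one]
    exact hsm
  have hd2 : ¬ ((2 : ℕ) : ℕ∞) ≤ idealOrder S (T.pt i) := by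
    rw [le_idealOrder_iff, hS, Ideal.span_singleton_le_iff_mem]
    exact hs2
  rw [← hd, Nat.cast_le] at hd1 hd2
  have hS1 : idealOrder S (T.pt i) = ((1 : ℕ) : ℕ∞) := by
    rw [← hd]
    congr 1
    omega
  -- `ord (s^{a-1} K)` is finite
  have hKne : stalkIdeal K (T.pt i) ≠ ⊥ := by
    intro hK0
    have : ((b + 1 : ℕ) : ℕ∞) ≤ idealOrder K (T.pt i) := by
      rw [le_idealOrder_iff, hK0]
      exact bot_le
    rw [hF.2.2, Nat.cast_le] at this
    omega
  have hK'ne : stalkIdeal K' (T.pt i) ≠ ⊥ := by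
    rw [hK', Ne, Ideal.mul_eq_bot, not_or]
    exact ⟨by rw [Ideal.span_singleton_eq_bot]; exact pow_ne_zero _ hs0, hKne⟩
  obtain ⟨c, hc⟩ := ENat.ne_top_iff_exists.mp (idealOrder_lt_top_of_stalkIdeal_ne_bot hK'ne).ne
  exact (occult_letters hocc).2.2.1 i 1 c S K' ⟨hD', hS1, hc.symm⟩ rfl

/-- stage instances packaged: the marked stalk of a rd-3 tower stage is a factorial regular local domain of dimension 3
with `ht 𝔪 = 3`. [folklore] -/
theorem height_maximalIdeal_eq_three (T : ForcedTower) (g : T.St 0 ⟶ Spec (.of k)) (hB : IsBase (T.St 0) g)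
    (h3 : ThreefoldTower T) (i : ℕ) :
    haveI : IsRegularLocalRing ((T.St i).presheaf.stalk (T.pt i)) := tower_isRegular T g hB i _
    (maximalIdeal ((T.St i).presheaf.stalk (T.pt i))).height = 3 := by
  haveI : IsRegularLocalRing ((T.St i).presheaf.stalk (T.pt i)) := tower_isRegular T g hB i _
  have h := IsLocalRing.maximalIdeal_height_eq_ringKrullDim (R := (T.St i).presheaf.stalk (T.pt i))
  rw [ringKrullDim_eq_three_of_threefoldTower h3 i] at h
  have h' : ((maximalIdeal ((T.St i).presheaf.stalk (T.pt i))).height : WithBot ℕ∞) = ((3 : ℕ∞) : WithBot ℕ∞) := h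
  exact WithBot.coe_inj.mp h'

/-- **(L1b) NEAR-BRANCH PRIMES HAVE HEIGHT EXACTLY TWO — the near-branches are CURVE GERMS** (`𝔮 ≠ 𝔪`, `ht 𝔪 = 3`, and
`ht 𝔮 ≤ 1` would make `𝔮` principal, (L1a)). [folklore] -/
theorem height_primeOfSpecializes_eq_two_of_mem_brSet (T : ForcedTower) (g : T.St 0 ⟶ Spec (.of k))
    (hB : IsBase (T.St 0) g) (hocc : ¬ LatentFactorTower T) (h3 : ThreefoldTower T) {i a b : ℕ}
    {G K : (T.St i).IdealSheafData} (hF : FactorAt T i a b G K) (hP : (stalkIdeal G (T.pt i)).IsPrincipal) (ha : 1 ≤ a)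
    {η : T.St i} (hη : η ∈ brSet T i a G) : (primeOfSpecializes hη.1).height = 2 := by
  haveI := (tower_isLocallyNoetherian_isRegular T g hB i).1
  have hreg := tower_isRegular T g hB i
  haveI : IsRegularLocalRing ((T.St i).presheaf.stalk (T.pt i)) := hreg _
  haveI : IsDomain ((T.St i).presheaf.stalk (T.pt i)) := isDomain_of_isRegularLocalRing _
  haveI : UniqueFactorizationMonoid ((T.St i).presheaf.stalk (T.pt i)) := hreg.uniqueFactorizationMonoid_stalk _
  have hnp := not_isPrincipal_primeOfSpecializes_of_mem_brSet T g hB hocc hF hP ha hη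
  have hlt : primeOfSpecializes hη.1 < maximalIdeal _ :=
    lt_of_le_of_ne (IsLocalRing.le_maximalIdeal (Ideal.IsPrime.ne_top inferInstance))
      (primeOfSpecializes_ne_maximalIdeal_of_ne hη.1 hη.2.1)
  have hm3 := height_maximalIdeal_eq_three T g hB h3 i
  have hq3 : (primeOfSpecializes hη.1).height < 3 := hm3 ▸ Ideal.height_strict_mono_of_isPrime_of_isPrime hlt
  have hq1 : ¬ (primeOfSpecializes hη.1).height ≤ 1 := fun h => hnp (isPrincipal_of_height_le_one h)
  obtain ⟨d, hd⟩ := ENat.ne_top_iff_exists.mp hq3.ne_top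
  rw [← hd] at hq3 hq1 ⊢
  have h3' : d < 3 := by exact_mod_cast hq3
  have h1' : ¬ d ≤ 1 := by exact_mod_cast hq1
  obtain rfl : d = 2 := by omega
  rfl

/-- **(L1c) NEAR-BRANCHES ARE MAXIMAL POINTS of the weight-`a` locus through `x_i`** (a proper generization in the locus
would be a near-branch with a strictly smaller prime, of height `< 2`). [folklore] -/
theorem brSet_subset_maxPoints (T : ForcedTower) (g : T.St 0 ⟶ Spec (.of k)) (hB : IsBase (T.St 0) g)
    (hocc : ¬ LatentFactorTower T) (h3 : ThreefoldTower T) {i a b : ℕ} {G K : (T.St i).IdealSheafData}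
    (hF : FactorAt T i a b G K) (hP : (stalkIdeal G (T.pt i)).IsPrincipal) (ha : 1 ≤ a) :
    brSet T i a G ⊆ maxPoints {z : T.St i | ((a : ℕ) : ℕ∞) ≤ idealOrder G z} := by
  intro η hη
  refine ⟨hη.2.2, fun η' hη' hs => ?_⟩
  by_contra hne
  have hη'b : η' ∈ brSet T i a G :=
    ⟨hs.trans hη.1, fun h => hη.2.1 (hη.1.antisymm (h ▸ hs)).eq, hη'⟩
  haveI : IsRegularLocalRing ((T.St i).presheaf.stalk (T.pt i)) := tower_isRegular T g hB i _
  have hlt := Ideal.height_strict_mono_of_isPrime_of_isPrime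
    (primeOfSpecializes_lt_of_specializes_of_ne hη.1 hη'b.1 hs hne)
  rw [height_primeOfSpecializes_eq_two_of_mem_brSet T g hB hocc h3 hF hP ha hη,
    height_primeOfSpecializes_eq_two_of_mem_brSet T g hB hocc h3 hF hP ha hη'b] at hlt
  exact lt_irrefl _ hlt

/-- **(L1d) THE NEAR-BRANCHES ARE FINITELY MANY** (maximal points of a closed set of a Noetherian scheme near a point are
finite; every generization of `x_i` lies in every open neighbourhood of `x_i`). [folklore] -/
theorem brSet_finite (T : ForcedTower) (g : T.St 0 ⟶ Spec (.of k)) (hB : IsBase (T.St 0) g)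
    (hocc : ¬ LatentFactorTower T) (h3 : ThreefoldTower T) {i a b : ℕ} {G K : (T.St i).IdealSheafData}
    (hF : FactorAt T i a b G K) (hP : (stalkIdeal G (T.pt i)).IsPrincipal) (ha : 1 ≤ a) : (brSet T i a G).Finite := by
  haveI := (tower_isLocallyNoetherian_isRegular T g hB i).1
  obtain ⟨U, hU, hxU, hfin⟩ :=
    exists_isOpen_finite_maxPoints_inter (isClosed_setOf_le_idealOrder_tower T g hB i G a) (T.pt i)
  exact hfin.subset fun η hη => ⟨brSet_subset_maxPoints T g hB hocc h3 hF hP ha hη, hη.1.mem_open hU hxU⟩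

/-- **(L1e) A NEAR-BRANCH IS A CURVE GERM: `dim 𝒪_{x_i}/𝔮 = 1`** (`ht 𝔮 + dim 𝒪/𝔮 = dim 𝒪 = 3` in the regular local ring,
`ht 𝔮 = 2`). [folklore] -/
theorem ringKrullDim_quotient_primeOfSpecializes_eq_one_of_mem_brSet (T : ForcedTower) (g : T.St 0 ⟶ Spec (.of k))
    (hB : IsBase (T.St 0) g) (hocc : ¬ LatentFactorTower T) (h3 : ThreefoldTower T) {i a b : ℕ}
    {G K : (T.St i).IdealSheafData} (hF : FactorAt T i a b G K) (hP : (stalkIdeal G (T.pt i)).IsPrincipal) (ha : 1 ≤ a)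
    {η : T.St i} (hη : η ∈ brSet T i a G) :
    ringKrullDim ((T.St i).presheaf.stalk (T.pt i) ⧸ primeOfSpecializes hη.1) = 1 := by
  haveI : IsRegularLocalRing ((T.St i).presheaf.stalk (T.pt i)) := tower_isRegular T g hB i _
  have hform := height_add_ringKrullDim_quotient (primeOfSpecializes hη.1)
  rw [ringKrullDim_eq_three_of_threefoldTower h3 i, height_primeOfSpecializes_eq_two_of_mem_brSet T g hB hocc h3 hF hP ha hη]
    at hform
  revert hform
  generalize ringKrullDim ((T.St i).presheaf.stalk (T.pt i) ⧸ primeOfSpecializes hη.1) = d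
  intro hform
  induction d using WithBot.recBotCoe with
  | bot => exact absurd hform (by simp)
  | coe e =>
    induction e using ENat.recTopCoe with
    | top =>
      have h : ((2 : ℕ∞) : WithBot ℕ∞) + ((⊤ : ℕ∞) : WithBot ℕ∞) = ((3 : ℕ∞) : WithBot ℕ∞) := hform
      rw [← WithBot.coe_add, WithBot.coe_inj, add_top] at h
      exact absurd h (by simp)
    | coe n =>
      have h : ((2 : ℕ∞) : WithBot ℕ∞) + ((n : ℕ∞) : WithBot ℕ∞) = ((3 : ℕ∞) : WithBot ℕ∞) := hform
      rw [← WithBot.coe_add, WithBot.coe_inj] at h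
      have h' : (2 : ℕ) + n = 3 := by exact_mod_cast h
      have hn : n = 1 := by omega
      subst hn
      rfl

/-- **(L1f) NO NEAR-BRANCH ⟹ THE MARKED POINT IS ISOLATED in the weight-`a` locus** (a point of the locus near `x_i`
generizes to a maximal point of the locus specializing to `x_i`; with no near-branch that maximal point is the closed
point `x_i` itself). [folklore] -/
theorem isIsolatedIn_of_brSet_eq_empty (T : ForcedTower) (g : T.St 0 ⟶ Spec (.of k)) (hB : IsBase (T.St 0) g) (i a : ℕ)
    (G : (T.St i).IdealSheafData) (hx : ((a : ℕ) : ℕ∞) ≤ idealOrder G (T.pt i)) (he : brSet T i a G = ∅) :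
    IsIsolatedIn {y : T.St i | ((a : ℕ) : ℕ∞) ≤ idealOrder G y} (T.pt i) := by
  haveI := (tower_isLocallyNoetherian_isRegular T g hB i).1
  have hZ := isClosed_setOf_le_idealOrder_tower T g hB i G a
  obtain ⟨U, hxU, hU⟩ := exists_nhds_mem_iff_exists_maxPoints_specializes hZ (T.pt i)
  refine ⟨hx, U, hxU, fun w hw => ?_⟩
  obtain ⟨η, hη, hηx, hηw⟩ := (hU w hw.1).mp hw.2
  by_cases hne : η = T.pt i
  · subst hne
    exact ((T.isClosed_pt i).closure_eq ▸ hηw.mem_closure : w ∈ ({T.pt i} : Set (T.St i)))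
  · exact absurd (show η ∈ brSet T i a G from ⟨hηx, hne, hη.1⟩) (he ▸ Set.notMem_empty η)

end BranchStructure

end Summit.ResolutionOfSingularities.ResolutionOfSingularities.Theorems.HugValuationCut
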